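import Mathlib.NumberTheory.Modular
import Mathlib.NumberTheory.ModularForms.ArithmeticSubgroups
import Mathlib.Analysis.Complex.UpperHalfPlane.ProperAction
import Mathlib.Analysis.Complex.UpperHalfPlane.Metric
import Literature.Probability.RandomPlanarGeometry.SquareLoops
import Literature.Probability.RandomPlanarGeometry.DiskMoebius
import Literature.Probability.RandomPlanarGeometry.LoopSpaceUniform
import HarnessLib

/-!
# The modular loop ensemble: a Möbius-covariant locally finite family of simple square loops

Support file for the discharge of the named fact
`Literature.Probability.RandomPlanarGeometry.exists_isCLEFamily` (`CLE.lean`). The ensemble built here is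
**not** a `CLE_κ` (no SLE, exploration tree or loop soup is involved): it is a deterministic
`SL(2, ℤ)`-tiling family moved by a random group element, which witnesses only the (much weaker, as
`CLE.lean` documents) v0 axioms `IsCLEFamily`. The deterministic skeleton of the random loop ensemble: the `SL(2, ℤ)`-translates of the boundaries of all dyadic squares
contained in the open standard fundamental domain `𝒟ᵒ` of the modular group, moved by an element
`g ∈ SL(2, ℝ)` and read in the unit disc through the Cayley transform (or through any continuous
`T : ℍ → ℂ`).

* `TileSquare`: the dyadic squares `Q ⊆ 𝒟ᵒ` (countably infinite); `TileSquare.bdryPt Q t ∈ ℍ`, the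
  square loop of `Q`; `sqCurve T h Q : Curve ℂ`, `t ↦ T (h • bdryPt Q t)`.
* `sqFamily T g = {[sqCurve T (g⁻¹ γ) Q] : γ ∈ SL(2, ℤ), Q}` and the loop collection
  `modularLoops g := closure (sqFamily cayleyH g) ∈ LoopSpace ℂ`.
* Covariance: `sqFamily T (γ g) = sqFamily T g` (`sqFamily_coe_mul`), push-forward by the disc Möbius map
  of `h` turns `modularLoops g` into `modularLoops (g h⁻¹)` (`map_diskMoebiusExt_modularLoops`);
  continuity of `g ↦ modularLoops g` (`continuous_modularLoops`).
* Local finiteness of `sqFamily cayleyH g` (`locFin_sqFamily`): proper discontinuity of `SL(2, ℤ)` on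
  `ℍ`, a cusp estimate, and the comparison of hyperbolic and Euclidean distances near the circle.
* Non-crossing of any two loops of `sqFamily T g` for injective `T`
  (`range_sqCurve_subset_closure_component`, `isNonCrossing_of_subset_sqFamily`), and the
  square-hitting lemma `exists_tileSquare_inter_nonempty` (a non-degenerate connected set through a
  point of `𝒟ᵒ` meets the boundary of a dyadic square of the family).

## References

* S. Sheffield, *Exploration trees and conformal loop ensembles*, Duke Math. J. 147 (2009), §1.1
  (the loop-ensemble axioms, in the v0 form of `CLE.lean`, that this family is built to witness).
* J.-P. Serre, *A Course in Arithmetic*, GTM 7 (1973), Ch. VII §1 (the fundamental domain of the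
  modular group; Mathlib `ModularGroup.fd`, `ModularGroup.fdo`).
-/

noncomputable section

open Set Filter Topology Complex Metric UpperHalfPlane
open scoped MatrixGroups Modular

namespace Literature.Probability.RandomPlanarGeometry

namespace ModularEnsemble

/-! ### The open fundamental domain as a subset of `ℂ` -/

/-- The coordinate image `{p ∈ ℂ : im p > 0, |p|² > 1, |re p| < 1/2}` of the open fundamental domain
`𝒟ᵒ` of the modular group (Serre, Ch. VII §1); this is the set of Mathlib's `ModularGroup.coe_fdo`
(stated there with `‖p‖`), see the bridge `image_coe_fdo`. [folklore] -/
def fdoC : Set ℂ := {p | 0 < p.im ∧ 1 < normSq p ∧ |p.re| < 2⁻¹}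

/-- Membership in `fdoC`. [folklore] -/
lemma mem_fdoC_iff {p : ℂ} : p ∈ fdoC ↔ 0 < p.im ∧ 1 < normSq p ∧ |p.re| < 2⁻¹ := Iff.rfl

/-- `fdoC` is open. [folklore] -/
lemma isOpen_fdoC : IsOpen fdoC :=
  (isOpen_lt continuous_const Complex.continuous_im).inter
    ((isOpen_lt continuous_const Complex.continuous_normSq).inter
      (isOpen_lt (continuous_abs.comp Complex.continuous_re) continuous_const))

/-- A point of `ℍ` lies in `𝒟ᵒ` iff its coordinate lies in `fdoC`. [folklore] -/
lemma mem_fdo_iff_coe_mem_fdoC (z : ℍ) : z ∈ 𝒟ᵒ ↔ (z : ℂ) ∈ fdoC := by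
  simp only [ModularGroup.fdo, mem_setOf_eq, mem_fdoC_iff, UpperHalfPlane.coe_re]
  exact ⟨fun h ↦ ⟨z.im_pos, h.1, by simpa using h.2⟩, fun h ↦ ⟨h.2.1, by simpa using h.2.2⟩⟩

/-- `fdoC` lies in the open upper half-plane `upperHalfPlaneSet`. [folklore] -/
lemma fdoC_subset_upper : fdoC ⊆ UpperHalfPlane.upperHalfPlaneSet := fun _ h ↦ h.1

/-- Points of `fdoC` have imaginary part `> 1/2` (indeed `> √3/2`). [folklore] -/
lemma half_lt_im_of_mem_fdoC {p : ℂ} (h : p ∈ fdoC) : 2⁻¹ < p.im := by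
  obtain ⟨h0, h1, h2⟩ := h
  rw [normSq_apply] at h1
  have h3 : p.re * p.re < 4⁻¹ := by
    have := abs_lt.1 h2
    nlinarith
  nlinarith

/-- **Bridge**: `fdoC` is the coordinate image of `𝒟ᵒ` (Mathlib's `ModularGroup.coe_fdo` describes the
same set with `‖z‖` in place of `normSq z`). [folklore] -/
lemma image_coe_fdo : ((↑) : ℍ → ℂ) '' (𝒟ᵒ : Set ℍ) = fdoC := by
  ext p
  constructor
  · rintro ⟨z, hz, rfl⟩
    exact (mem_fdo_iff_coe_mem_fdoC z).1 hz
  · intro hp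
    exact ⟨⟨p, hp.1⟩, (mem_fdo_iff_coe_mem_fdoC _).2 hp, rfl⟩

/-! ### Dyadic squares in the open fundamental domain -/

/-- A **tile square**: a dyadic square `[a 2⁻ᵏ, (a+1) 2⁻ᵏ] × [b 2⁻ᵏ, (b+1) 2⁻ᵏ]` contained in the open
fundamental domain of the modular group. [folklore] -/
structure TileSquare where
  /-- The dyadic level. -/
  k : ℕ
  /-- The horizontal index. -/
  a : ℤ
  /-- The vertical index. -/
  b : ℤ
  /-- The closed square lies in (the coordinate image of) `𝒟ᵒ`. -/
  subset_fdoC : sqSet (dyCenter k a b) (dyRad k) ⊆ fdoC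

namespace TileSquare

variable (Q : TileSquare)

/-- The centre of a tile square. [folklore] -/
def center : ℂ := dyCenter Q.k Q.a Q.b

/-- The half-side of a tile square. [folklore] -/
def rad : ℝ := dyRad Q.k

/-- The half-side is positive. [folklore] -/
lemma rad_pos : 0 < Q.rad := dyRad_pos Q.k

/-- The half-side is at most `1/2`. [folklore] -/
lemma rad_le_half : Q.rad ≤ 2⁻¹ := dyRad_le_half Q.k

/-- The closed square (in `ℂ`). [folklore] -/
def cset : Set ℂ := sqSet Q.center Q.rad

/-- The closed square lies in `fdoC`. [folklore] -/
lemma cset_subset_fdoC : Q.cset ⊆ fdoC := Q.subset_fdoC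

/-- Points of the closed square have positive imaginary part. [folklore] -/
lemma im_pos_of_mem_cset {p : ℂ} (hp : p ∈ Q.cset) : 0 < p.im := (Q.cset_subset_fdoC hp).1

/-- Points of the closed square have imaginary part `> 1/2`. [folklore] -/
lemma half_lt_im_of_mem_cset {p : ℂ} (hp : p ∈ Q.cset) : 2⁻¹ < p.im :=
  half_lt_im_of_mem_fdoC (Q.cset_subset_fdoC hp)

/-- A tile square is determined by its indices. [folklore] -/
lemma ext' {Q Q' : TileSquare} (hk : Q.k = Q'.k) (ha : Q.a = Q'.a) (hb : Q.b = Q'.b) : Q = Q' := by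
  cases Q; cases Q'; cases hk; cases ha; cases hb; rfl

/-- The index map of tile squares is injective. [folklore] -/
lemma injective_index : Function.Injective fun Q : TileSquare ↦ (Q.k, Q.a, Q.b) := by
  intro Q Q' h
  simp only [Prod.mk.injEq] at h
  exact ext' h.1 h.2.1 h.2.2

/-- Tile squares form a countable family. [folklore] -/
instance : Countable TileSquare := injective_index.countable

/-- The tile squares `[-1/4, 0] × [(8 + n)/4, (9 + n)/4]`, `n ∈ ℕ`, high in the cusp. [folklore] -/
def high (n : ℕ) : TileSquare where
  k := 2
  a := -1
  b := 8 + n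
  subset_fdoC := by
    intro p hp
    rw [mem_dySq_iff] at hp
    obtain ⟨h1, h2, h3, h4⟩ := hp
    push_cast at h1 h2 h3 h4
    have hn : (0 : ℝ) ≤ n := n.cast_nonneg
    refine ⟨by nlinarith, ?_, ?_⟩
    · rw [normSq_apply]; nlinarith
    · rw [abs_lt]; constructor <;> nlinarith

/-- The cusp squares are pairwise distinct. [folklore] -/
lemma injective_high : Function.Injective high := by
  intro m n h
  have := congrArg TileSquare.b h
  simpa [high] using this

/-- There are infinitely many tile squares. [folklore] -/
instance : Infinite TileSquare := Infinite.of_injective high injective_high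

/-- There is a tile square. [folklore] -/
instance : Nonempty TileSquare := ⟨high 0⟩

/-- The point `squareLoop t` of the boundary of the square, as a point of `ℍ`. [folklore] -/
def bdryPt (t : unitInterval) : ℍ :=
  ⟨squareLoop Q.center Q.rad t, Q.im_pos_of_mem_cset (range_squareLoop_subset_sqSet _ Q.rad_pos.le ⟨t, rfl⟩)⟩

/-- The coordinate of `bdryPt`. [folklore] -/
@[simp] lemma coe_bdryPt (t : unitInterval) : ((Q.bdryPt t : ℍ) : ℂ) = squareLoop Q.center Q.rad t := rfl

/-- `bdryPt` is continuous. [folklore] -/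
lemma continuous_bdryPt : Continuous Q.bdryPt := by
  rw [UpperHalfPlane.isEmbedding_coe.continuous_iff]
  exact (squareLoop Q.center Q.rad).continuous

/-- The closed square as a subset of `ℍ`. [folklore] -/
def setH : Set ℍ := ((↑) : ℍ → ℂ) ⁻¹' Q.cset

/-- The open square as a subset of `ℍ`. [folklore] -/
def intH : Set ℍ := ((↑) : ℍ → ℂ) ⁻¹' sqInt Q.center Q.rad

/-- The boundary of the square as a subset of `ℍ`. [folklore] -/
def bdryH : Set ℍ := ((↑) : ℍ → ℂ) ⁻¹' sqBdry Q.center Q.rad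

/-- The boundary is the range of `bdryPt`. [folklore] -/
lemma range_bdryPt : range Q.bdryPt = Q.bdryH := by
  ext z
  simp only [mem_range, bdryH, mem_preimage, ← range_squareLoop Q.center Q.rad_pos]
  constructor
  · rintro ⟨t, rfl⟩; exact ⟨t, rfl⟩
  · rintro ⟨t, ht⟩; exact ⟨t, UpperHalfPlane.ext (by rw [coe_bdryPt, ht])⟩

/-- The boundary lies in the closed square. [folklore] -/
lemma bdryH_subset_setH : Q.bdryH ⊆ Q.setH := fun _ h ↦ sqBdry_subset_sqSet _ _ h

/-- The open square lies in the closed square. [folklore] -/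
lemma intH_subset_setH : Q.intH ⊆ Q.setH := fun _ h ↦ sqInt_subset_sqSet _ _ h

/-- The closed square (in `ℍ`) lies in `𝒟ᵒ`. [folklore] -/
lemma setH_subset_fdo : Q.setH ⊆ 𝒟ᵒ := fun z hz ↦ (mem_fdo_iff_coe_mem_fdoC z).2 (Q.cset_subset_fdoC hz)

/-- The closed square (in `ℍ`) lies in `𝒟`. [folklore] -/
lemma setH_subset_fd : Q.setH ⊆ 𝒟 := Q.setH_subset_fdo.trans ModularGroup.fdo_subset_fd

/-- The coordinate image of `setH` is the closed square. [folklore] -/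
lemma image_coe_setH : ((↑) : ℍ → ℂ) '' Q.setH = Q.cset := by
  refine (image_preimage_subset _ _).antisymm fun p hp ↦ ?_
  exact ⟨⟨p, Q.im_pos_of_mem_cset hp⟩, hp, rfl⟩

/-- The coordinate image of `intH` is the open square. [folklore] -/
lemma image_coe_intH : ((↑) : ℍ → ℂ) '' Q.intH = sqInt Q.center Q.rad := by
  refine (image_preimage_subset _ _).antisymm fun p hp ↦ ?_
  exact ⟨⟨p, Q.im_pos_of_mem_cset (sqInt_subset_sqSet _ _ hp)⟩, hp, rfl⟩

/-- Two points of the closed square are at hyperbolic distance at most `4`: their Euclidean distance is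
at most `4 · rad ≤ 2` and their imaginary parts exceed `1/2`. [folklore] -/
lemma dist_le_four {z w : ℍ} (hz : z ∈ Q.setH) (hw : w ∈ Q.setH) : dist z w ≤ 4 := by
  have h1 : dist (z : ℂ) w ≤ 2 := by
    have := dist_le_of_mem_sqSet hz hw
    linarith [Q.rad_le_half]
  have hz' : 2⁻¹ < z.im := by have := Q.half_lt_im_of_mem_cset hz; rwa [UpperHalfPlane.coe_im] at this
  have hw' : 2⁻¹ < w.im := by have := Q.half_lt_im_of_mem_cset hw; rwa [UpperHalfPlane.coe_im] at this
  have h2 : 2⁻¹ ≤ Real.sqrt (z.im * w.im) := by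
    refine Real.le_sqrt_of_sq_le ?_
    nlinarith
  calc dist z w ≤ dist (z : ℂ) w / Real.sqrt (z.im * w.im) := dist_le_dist_coe_div_sqrt z w
    _ ≤ 2 / 2⁻¹ := by
        gcongr
    _ = 4 := by norm_num

end TileSquare

/-! ### The square loops moved by `SL(2, ℝ)` and read through `T : ℍ → ℂ` -/

/-- The Cayley transform as a continuous map `ℍ → ℂ` (into the unit disc). [folklore] -/
def cayleyH : C(ℍ, ℂ) :=
  ⟨fun z ↦ cayleyFun z, continuousOn_cayleyFun.comp_continuous continuous_coe
    fun z ↦ add_I_ne_zero z.im_pos.le⟩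

/-- Unfolding `cayleyH`. [folklore] -/
@[simp] lemma cayleyH_apply (z : ℍ) : cayleyH z = cayleyFun z := rfl

/-- `cayleyH` takes values in the open unit disc. [folklore] -/
lemma norm_cayleyH_lt_one (z : ℍ) : ‖cayleyH z‖ < 1 := norm_cayleyFun_coe_lt_one z

/-- `cayleyH` is injective. [folklore] -/
lemma injective_cayleyH : Function.Injective cayleyH := by
  intro z w h
  apply UpperHalfPlane.ext
  have hz := cayleyInvFun_cayleyFun (add_I_ne_zero z.im_pos.le)
  have hw := cayleyInvFun_cayleyFun (add_I_ne_zero w.im_pos.le)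
  rw [cayleyH_apply, cayleyH_apply] at h
  rw [← hz, ← hw, h]

/-- **The square loop of `Q`, moved by `h ∈ SL(2, ℝ)` and read through `T`**: the curve
`t ↦ T (h • bdryPt Q t)`. [folklore] -/
def sqCurve (T : C(ℍ, ℂ)) (h : SL(2, ℝ)) (Q : TileSquare) : Curve ℂ :=
  ⟨⟨fun t ↦ T (h • Q.bdryPt t), T.continuous.comp ((continuous_const_smul h).comp Q.continuous_bdryPt)⟩⟩

/-- Pointwise formula for `sqCurve`. [folklore] -/
@[simp] lemma sqCurve_apply (T : C(ℍ, ℂ)) (h : SL(2, ℝ)) (Q : TileSquare) (t : unitInterval) :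
    sqCurve T h Q t = T (h • Q.bdryPt t) := rfl

/-- The trace of `sqCurve T h Q` is `T (h • ∂Q)`. [folklore] -/
lemma range_sqCurve (T : C(ℍ, ℂ)) (h : SL(2, ℝ)) (Q : TileSquare) :
    (sqCurve T h Q).range = T '' ((h • ·) '' Q.bdryH) := by
  rw [← Q.range_bdryPt, ← range_comp, ← range_comp]
  rfl

/-- Reading through `Φ ∘ T` is pushing forward the curve read through `T`. [folklore] -/
lemma sqCurve_comp (Φ : C(ℂ, ℂ)) (T : C(ℍ, ℂ)) (h : SL(2, ℝ)) (Q : TileSquare) :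
    sqCurve (Φ.comp T) h Q = (sqCurve T h Q).map Φ := rfl

/-- `sqCurve T h Q` is a loop. [folklore] -/
lemma isLoop_sqCurve (T : C(ℍ, ℂ)) (h : SL(2, ℝ)) (Q : TileSquare) : (sqCurve T h Q).IsLoop := by
  change T (h • Q.bdryPt 0) = T (h • Q.bdryPt 1)
  congr 2
  exact UpperHalfPlane.ext (isLoop_squareLoop Q.center Q.rad)

/-- For injective `T`, `sqCurve T h Q` is a simple loop. [folklore] -/
lemma isSimpleLoop_sqCurve {T : C(ℍ, ℂ)} (hT : Function.Injective T) (h : SL(2, ℝ))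
    (Q : TileSquare) : (sqCurve T h Q).IsSimpleLoop := by
  refine ⟨isLoop_sqCurve T h Q, fun s hs t ht hst ↦ ?_⟩
  simp only [sqCurve_apply] at hst
  have h1 : Q.bdryPt s = Q.bdryPt t := smul_left_cancel h (hT hst)
  have h2 : squareLoop Q.center Q.rad s = squareLoop Q.center Q.rad t := by
    rw [← Q.coe_bdryPt, ← Q.coe_bdryPt, h1]
  exact (isSimpleLoop_squareLoop Q.center Q.rad_pos.ne').2 hs ht h2

/-- For injective `T`, the trace of `sqCurve T h Q` has two distinct points (the loop is
non-trivial). [folklore] -/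
lemma not_isTrivial_mk_sqCurve {T : C(ℍ, ℂ)} (hT : Function.Injective T) (h : SL(2, ℝ))
    (Q : TileSquare) : ¬ (CurveClass.mk (sqCurve T h Q)).IsTrivial := by
  intro htriv
  rw [CurveClass.isTrivial_iff, CurveClass.range_mk] at htriv
  -- the parameters `0` and `1/2` give distinct points
  have hmem : ∀ t : unitInterval, sqCurve T h Q t ∈ (sqCurve T h Q).range := fun t ↦ ⟨t, rfl⟩
  have half_mem : (2⁻¹ : ℝ) ∈ unitInterval := ⟨by norm_num, by norm_num⟩
  have heq := htriv (hmem 0) (hmem ⟨2⁻¹, half_mem⟩)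
  have hinj := (isSimpleLoop_sqCurve hT h Q).2 (show (0 : unitInterval) ∈ Iio 1 from Set.mem_Iio.2 zero_lt_one)
    (show (⟨2⁻¹, half_mem⟩ : unitInterval) ∈ Iio 1 from by
      change (⟨2⁻¹, half_mem⟩ : unitInterval) < 1; exact Subtype.mk_lt_mk.2 (by norm_num)) heq
  have := congrArg Subtype.val hinj
  norm_num at this

/-! ### The family of loops and the loop collection -/

/-- The image of `γ ∈ SL(2, ℤ)` in `SL(2, ℝ)` acts on `ℍ` as `γ` does. [folklore] -/
lemma coe_smul_eq (γ : SL(2, ℤ)) (z : ℍ) : ((γ : SL(2, ℝ)) • z) = γ • z :=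
  (MulAction.compHom_smul_def (Matrix.SpecialLinearGroup.mapGL ℝ) γ z).symm

/-- **The family of square loops driven by `g ∈ SL(2, ℝ)`**: the classes of the curves
`t ↦ T ((g⁻¹ γ) • ∂Q(t))`, `γ ∈ SL(2, ℤ)`, `Q` a tile square. [folklore] -/
def sqFamily (T : C(ℍ, ℂ)) (g : SL(2, ℝ)) : Set (CurveClass ℂ) :=
  range fun i : SL(2, ℤ) × TileSquare ↦ CurveClass.mk (sqCurve T (g⁻¹ * (i.1 : SL(2, ℝ))) i.2)

/-- Membership of the generating loops in the family. [folklore] -/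
lemma mk_sqCurve_mem_sqFamily (T : C(ℍ, ℂ)) (g : SL(2, ℝ)) (γ : SL(2, ℤ)) (Q : TileSquare) :
    CurveClass.mk (sqCurve T (g⁻¹ * (γ : SL(2, ℝ))) Q) ∈ sqFamily T g := ⟨(γ, Q), rfl⟩

/-- Countability of `SL(2, ℤ)`. [folklore] -/
instance : Countable SL(2, ℤ) := by
  haveI : Countable (Matrix (Fin 2) (Fin 2) ℤ) := inferInstanceAs (Countable (Fin 2 → Fin 2 → ℤ))
  exact Subtype.countable

/-- The family of square loops is countable. [folklore] -/
lemma countable_sqFamily (T : C(ℍ, ℂ)) (g : SL(2, ℝ)) : (sqFamily T g).Countable :=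
  countable_range _

/-- All members of the family are loops. [folklore] -/
lemma isLoop_of_mem_sqFamily {T : C(ℍ, ℂ)} {g : SL(2, ℝ)} {c : CurveClass ℂ} (hc : c ∈ sqFamily T g) :
    c.IsLoop := by
  obtain ⟨⟨γ, Q⟩, rfl⟩ := hc
  exact CurveClass.isLoop_mk.2 (isLoop_sqCurve _ _ _)

/-- For injective `T` all members of the family are simple loops. [folklore] -/
lemma mem_simpleLoop_of_mem_sqFamily {T : C(ℍ, ℂ)} (hT : Function.Injective T) {g : SL(2, ℝ)}
    {c : CurveClass ℂ} (hc : c ∈ sqFamily T g) : c ∈ (CurveClass.simpleLoop : Set (CurveClass ℂ)) := by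
  obtain ⟨⟨γ, Q⟩, rfl⟩ := hc
  exact CurveClass.mk_mem_simpleLoop (isSimpleLoop_sqCurve hT _ _)

/-- For injective `T` no member of the family is trivial. [folklore] -/
lemma not_isTrivial_of_mem_sqFamily {T : C(ℍ, ℂ)} (hT : Function.Injective T) {g : SL(2, ℝ)}
    {c : CurveClass ℂ} (hc : c ∈ sqFamily T g) : ¬ c.IsTrivial := by
  obtain ⟨⟨γ, Q⟩, rfl⟩ := hc
  exact not_isTrivial_mk_sqCurve hT _ _

/-- The traces of the members of the family lie in the range of `T`. [folklore] -/
lemma range_subset_of_mem_sqFamily {T : C(ℍ, ℂ)} {g : SL(2, ℝ)} {c : CurveClass ℂ}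
    (hc : c ∈ sqFamily T g) : c.range ⊆ range T := by
  obtain ⟨⟨γ, Q⟩, rfl⟩ := hc
  rw [CurveClass.range_mk, range_sqCurve]
  exact image_subset_range _ _

/-- Reading through `Φ ∘ T` is pushing the family forward along `Φ`. [folklore] -/
lemma sqFamily_comp (Φ : C(ℂ, ℂ)) (T : C(ℍ, ℂ)) (g : SL(2, ℝ)) :
    sqFamily (Φ.comp T) g = CurveClass.map Φ '' sqFamily T g := by
  rw [sqFamily, sqFamily, ← range_comp]
  rfl

/-- **`SL(2, ℤ)`-invariance of the family**: replacing `g` by `γ₀ g` re-indexes the family. [folklore] -/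
lemma sqFamily_coe_mul (T : C(ℍ, ℂ)) (γ₀ : SL(2, ℤ)) (g : SL(2, ℝ)) :
    sqFamily T ((γ₀ : SL(2, ℝ)) * g) = sqFamily T g := by
  ext c
  constructor
  · rintro ⟨⟨γ, Q⟩, rfl⟩
    refine ⟨(γ₀⁻¹ * γ, Q), ?_⟩
    simp only [map_mul, map_inv, mul_inv_rev, mul_assoc]
  · rintro ⟨⟨γ, Q⟩, rfl⟩
    refine ⟨(γ₀ * γ, Q), ?_⟩
    simp only [map_mul, mul_inv_rev, mul_assoc, inv_mul_cancel_left]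

/-- **Möbius covariance of the family read through the Cayley transform**: pushing forward along a map
`M` that agrees with the disc Möbius map of `h` on the open disc turns the family of `g` into the
family of `g h⁻¹`. [folklore] -/
lemma image_map_sqFamily_cayleyH {M : C(ℂ, ℂ)} {h : SL(2, ℝ)}
    (hM : ∀ w : ℂ, ‖w‖ < 1 → M w = diskMoebius h w) (g : SL(2, ℝ)) :
    CurveClass.map M '' sqFamily cayleyH g = sqFamily cayleyH (g * h⁻¹) := by
  have key : ∀ (h' : SL(2, ℝ)) (Q : TileSquare),
      (sqCurve cayleyH h' Q).map M = sqCurve cayleyH (h * h') Q := by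
    intro h' Q
    ext t
    change M (cayleyFun ((h' • Q.bdryPt t : ℍ) : ℂ)) = cayleyFun (((h * h') • Q.bdryPt t : ℍ) : ℂ)
    rw [hM _ (norm_cayleyFun_coe_lt_one _), ← cayleyFun_smul, mul_smul]
  have key' : ∀ (γ : SL(2, ℤ)) (Q : TileSquare),
      CurveClass.map M (CurveClass.mk (sqCurve cayleyH (g⁻¹ * (γ : SL(2, ℝ))) Q)) =
        CurveClass.mk (sqCurve cayleyH ((g * h⁻¹)⁻¹ * (γ : SL(2, ℝ))) Q) := by
    intro γ Q
    rw [CurveClass.map_mk, key, mul_inv_rev, inv_inv, mul_assoc]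
  ext c
  simp only [sqFamily, mem_image, mem_range, Prod.exists]
  constructor
  · rintro ⟨_, ⟨γ, Q, rfl⟩, rfl⟩
    exact ⟨γ, Q, (key' γ Q).symm⟩
  · rintro ⟨γ, Q, rfl⟩
    exact ⟨_, ⟨γ, Q, rfl⟩, key' γ Q⟩

/-- **The modular loop collection driven by `g ∈ SL(2, ℝ)`**: the closure in curve space of the
family of Cayley images of the square loops `(g⁻¹ γ) • ∂Q`. [folklore] -/
def modularLoops (g : SL(2, ℝ)) : LoopSpace ℂ :=
  TopologicalSpace.Closeds.closure (sqFamily cayleyH g)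

/-- The underlying set of `modularLoops g`. [folklore] -/
lemma coe_modularLoops (g : SL(2, ℝ)) :
    (modularLoops g : Set (CurveClass ℂ)) = closure (sqFamily cayleyH g) := rfl

/-- The generating loops belong to the collection. [folklore] -/
lemma sqFamily_subset_modularLoops (g : SL(2, ℝ)) :
    sqFamily cayleyH g ⊆ (modularLoops g : Set (CurveClass ℂ)) := subset_closure

/-- **`SL(2, ℤ)`-invariance of the collection.** [folklore] -/
lemma modularLoops_coe_mul (γ₀ : SL(2, ℤ)) (g : SL(2, ℝ)) :
    modularLoops ((γ₀ : SL(2, ℝ)) * g) = modularLoops g := by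
  rw [modularLoops, modularLoops, sqFamily_coe_mul]

/-- **Möbius covariance of the collection**: the push-forward along the (extended) disc Möbius map of
`h` of the collection driven by `g` is the collection driven by `g h⁻¹`. [folklore] -/
theorem map_diskMoebiusExt_modularLoops (h g : SL(2, ℝ)) :
    LoopSpace.map (diskMoebiusExt h) (modularLoops g) = modularLoops (g * h⁻¹) := by
  rw [modularLoops, LoopSpace.map_closure_eq_of_uniformContinuous (uniformContinuous_diskMoebiusExt h),
    image_map_sqFamily_cayleyH (fun w hw ↦ diskMoebiusExt_of_norm_le_one h hw.le)]
  rfl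

/-- More generally, any continuous `M` agreeing with the disc Möbius map of `h` on the open disc and
uniformly continuous on `ℂ` pushes `modularLoops g` to `modularLoops (g h⁻¹)`. [folklore] -/
theorem map_modularLoops_of_eqOn_ball {M : C(ℂ, ℂ)} {h : SL(2, ℝ)} (hMu : UniformContinuous M)
    (hM : ∀ w : ℂ, ‖w‖ < 1 → M w = diskMoebius h w) (g : SL(2, ℝ)) :
    LoopSpace.map M (modularLoops g) = modularLoops (g * h⁻¹) := by
  rw [modularLoops, LoopSpace.map_closure_eq_of_uniformContinuous hMu, image_map_sqFamily_cayleyH hM]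
  rfl

/-- The collection is carried by the closed unit disc. [folklore] -/
lemma modularLoops_mem_carried (g : SL(2, ℝ)) : modularLoops g ∈ LoopSpace.carried (closedBall (0 : ℂ) 1) := by
  intro c hc
  refine CurveClass.range_subset_of_mem_closure isClosed_closedBall (fun c hc ↦ ?_) hc
  exact (range_subset_of_mem_sqFamily hc).trans (range_subset_iff.2 fun z ↦
    mem_closedBall_zero_iff.2 (norm_cayleyH_lt_one z).le)

/-! ### Continuity of `g ↦ modularLoops g` -/

/-- Pointwise, the loops driven by `g` are those driven by `1` moved by the disc Möbius map of `g⁻¹`: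
`sqCurve cayleyH (g⁻¹ γ) Q t = diskMoebius g⁻¹ (C (γ • ∂Q(t)))`. [folklore] -/
lemma sqCurve_cayleyH_apply_eq (g : SL(2, ℝ)) (γ : SL(2, ℤ)) (Q : TileSquare) (t : unitInterval) :
    sqCurve cayleyH (g⁻¹ * (γ : SL(2, ℝ))) Q t =
      diskMoebius g⁻¹ (cayleyFun (((γ : SL(2, ℝ)) • Q.bdryPt t : ℍ) : ℂ)) := by
  rw [sqCurve_apply, cayleyH_apply, mul_smul, cayleyFun_smul]

/-- **Uniform control of the collections**: if the disc Möbius maps of `g⁻¹` and `g₀⁻¹` are uniformly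
`ε`-close on the closed disc, the collections driven by `g` and `g₀` are at Hausdorff edistance `≤ ε`.
[folklore] -/
theorem edist_modularLoops_le {g g₀ : SL(2, ℝ)} {ε : ℝ} (hε : 0 ≤ ε)
    (h : ∀ w ∈ closedBall (0 : ℂ) 1, dist (diskMoebius g⁻¹ w) (diskMoebius g₀⁻¹ w) ≤ ε) :
    edist (modularLoops g) (modularLoops g₀) ≤ ENNReal.ofReal ε := by
  have key : ∀ (g g₀ : SL(2, ℝ)),
      (∀ w ∈ closedBall (0 : ℂ) 1, dist (diskMoebius g⁻¹ w) (diskMoebius g₀⁻¹ w) ≤ ε) →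
      ∀ x ∈ sqFamily cayleyH g, ∃ y ∈ sqFamily cayleyH g₀, edist x y ≤ ENNReal.ofReal ε := by
    intro g g₀ h
    rintro _ ⟨⟨γ, Q⟩, rfl⟩
    refine ⟨_, mk_sqCurve_mem_sqFamily cayleyH g₀ γ Q, ?_⟩
    rw [edist_dist, CurveClass.dist_mk_mk]
    refine ENNReal.ofReal_le_ofReal ((Curve.dist_le_dist_toContinuousMap _ _).trans ?_)
    refine (ContinuousMap.dist_le hε).2 fun t ↦ ?_
    change dist (sqCurve cayleyH (g⁻¹ * (γ : SL(2, ℝ))) Q t) (sqCurve cayleyH (g₀⁻¹ * (γ : SL(2, ℝ))) Q t) ≤ ε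
    rw [sqCurve_cayleyH_apply_eq, sqCurve_cayleyH_apply_eq]
    exact h _ (mem_closedBall_zero_iff.2 (norm_cayleyFun_coe_lt_one _).le)
  rw [TopologicalSpace.Closeds.edist_eq, coe_modularLoops, coe_modularLoops, hausdorffEDist_closure]
  refine hausdorffEDist_le_of_mem_edist (key g g₀ h) (key g₀ g fun w hw ↦ ?_)
  rw [dist_comm]
  exact h w hw

/-- **Continuity of the collection in the driving element** `g ∈ SL(2, ℝ)`. [folklore] -/
theorem continuous_modularLoops : Continuous modularLoops := by
  refine continuous_iff_continuousAt.2 fun g₀ ↦ ?_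
  rw [ContinuousAt, EMetric.tendsto_nhds]
  intro ε hε
  obtain ⟨ε', -, hpos, hε'⟩ := ENNReal.lt_iff_exists_real_btwn.1 hε
  have hε'pos : 0 < ε' := ENNReal.ofReal_pos.1 hpos
  have hev := (continuous_inv.tendsto g₀).eventually
    (eventually_forall_dist_diskMoebius_lt g₀⁻¹ hε'pos)
  filter_upwards [hev] with g hg
  exact (edist_modularLoops_le hε'pos.le fun w hw ↦ (hg w hw).le).trans_lt hε'

/-! ### Local finiteness of the family -/

namespace TileSquare

variable (Q : TileSquare)

/-- Two points of the closed square, as points of `ℍ`, have hyperbolic distance at most twice their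
Euclidean distance (imaginary parts `> 1/2`). [folklore] -/
lemma dist_le_two_mul_dist_coe {z w : ℍ} (hz : z ∈ Q.setH) (hw : w ∈ Q.setH) :
    dist z w ≤ 2 * dist (z : ℂ) w := by
  have hz' : 2⁻¹ < z.im := by have := Q.half_lt_im_of_mem_cset hz; rwa [UpperHalfPlane.coe_im] at this
  have hw' : 2⁻¹ < w.im := by have := Q.half_lt_im_of_mem_cset hw; rwa [UpperHalfPlane.coe_im] at this
  have h2 : 2⁻¹ ≤ Real.sqrt (z.im * w.im) := by
    refine Real.le_sqrt_of_sq_le ?_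
    nlinarith
  calc dist z w ≤ dist (z : ℂ) w / Real.sqrt (z.im * w.im) := dist_le_dist_coe_div_sqrt z w
    _ ≤ dist (z : ℂ) w / 2⁻¹ := by gcongr
    _ = 2 * dist (z : ℂ) w := by ring

/-- Two points of the closed square have hyperbolic distance at most `8 · rad`. [folklore] -/
lemma dist_le_eight_mul_rad {z w : ℍ} (hz : z ∈ Q.setH) (hw : w ∈ Q.setH) :
    dist z w ≤ 8 * Q.rad := by
  have := dist_le_of_mem_sqSet hz hw
  linarith [Q.dist_le_two_mul_dist_coe hz hw]

/-- The centre of the square, as a point of `ℍ`, lies in the closed square. [folklore] -/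
lemma center_mem_setH : (⟨Q.center, Q.im_pos_of_mem_cset (sqInt_subset_sqSet _ _
    (center_mem_sqInt Q.center Q.rad_pos))⟩ : ℍ) ∈ Q.setH :=
  sqInt_subset_sqSet _ _ (center_mem_sqInt Q.center Q.rad_pos)

/-- The closed square (in `ℍ`) is nonempty. [folklore] -/
lemma setH_nonempty : Q.setH.Nonempty := ⟨_, Q.center_mem_setH⟩

/-- Index bounds: the horizontal index satisfies `|a| ≤ 2ᵏ`. [folklore] -/
lemma abs_a_le : |Q.a| ≤ 2 ^ Q.k := by
  have hc : Q.center ∈ Q.cset := sqInt_subset_sqSet _ _ (center_mem_sqInt Q.center Q.rad_pos)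
  have hre := (abs_lt.1 (Q.cset_subset_fdoC hc).2.2)
  have e : Q.center.re = ((Q.a : ℝ) + 2⁻¹) / 2 ^ Q.k := rfl
  rw [e] at hre
  have hP : (0 : ℝ) < 2 ^ Q.k := by positivity
  rw [lt_div_iff₀ hP] at hre
  have h2 := hre.2
  rw [div_lt_iff₀ hP] at h2
  have h1P : (1 : ℝ) ≤ 2 ^ Q.k := one_le_pow₀ (by norm_num)
  have : |(Q.a : ℝ)| ≤ 2 ^ Q.k := by rw [abs_le]; constructor <;> nlinarith
  exact_mod_cast this

/-- Index bounds: the vertical index is non-negative. [folklore] -/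
lemma b_nonneg : 0 ≤ Q.b := by
  have hc : Q.center ∈ Q.cset := sqInt_subset_sqSet _ _ (center_mem_sqInt Q.center Q.rad_pos)
  have him := half_lt_im_of_mem_fdoC (Q.cset_subset_fdoC hc)
  have e : Q.center.im = ((Q.b : ℝ) + 2⁻¹) / 2 ^ Q.k := rfl
  rw [e, lt_div_iff₀ (by positivity : (0 : ℝ) < 2 ^ Q.k)] at him
  have h1P : (1 : ℝ) ≤ 2 ^ Q.k := one_le_pow₀ (by norm_num)
  have : (-1 : ℝ) < Q.b := by nlinarith
  have : (-1 : ℤ) < Q.b := by exact_mod_cast this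
  omega

/-- Index bounds: if some point of the square has imaginary part `≤ Y` then `b ≤ (Y + 2) 2ᵏ`. [folklore] -/
lemma b_le_of_exists_im_le {Y : ℝ} (h : ∃ z ∈ Q.setH, z.im ≤ Y) : (Q.b : ℝ) ≤ (Y + 2) * 2 ^ Q.k := by
  obtain ⟨z, hz, hzY⟩ := h
  have hc : Q.center ∈ Q.cset := sqInt_subset_sqSet _ _ (center_mem_sqInt Q.center Q.rad_pos)
  have hd : dist (z : ℂ) Q.center ≤ 2 := by
    have := dist_le_of_mem_sqSet hz hc
    linarith [Q.rad_le_half]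
  have him : Q.center.im ≤ Y + 2 := by
    have h1 : |(z : ℂ).im - Q.center.im| ≤ 2 := by
      have := abs_im_le_norm ((z : ℂ) - Q.center)
      rw [sub_im] at this
      rw [dist_eq_norm] at hd
      linarith
    rw [UpperHalfPlane.coe_im] at h1
    have := (abs_le.1 h1).1
    linarith
  have e : Q.center.im = ((Q.b : ℝ) + 2⁻¹) / 2 ^ Q.k := rfl
  rw [e, div_le_iff₀ (by positivity : (0 : ℝ) < 2 ^ Q.k)] at him
  have h1P : (0 : ℝ) ≤ 2 ^ Q.k := by positivity
  nlinarith

end TileSquare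

/-- **Cusp estimate**: if `γ ∈ SL(2, ℤ)` moves `z` to a point with imaginary part in `[m, M]`,
`m > 0`, then `im z ≤ max M m⁻¹` (the lower-left entry of `γ` is `0` or at least `1` in absolute
value). [folklore] -/
lemma im_le_of_im_smul_mem {γ : SL(2, ℤ)} {z : ℍ} {m M : ℝ} (hm : 0 < m) (h1 : m ≤ (γ • z).im)
    (h2 : (γ • z).im ≤ M) : z.im ≤ max M m⁻¹ := by
  rw [ModularGroup.im_smul_eq_div_normSq, ModularGroup.denom_apply] at h1 h2
  have hns : normSq ((((γ 1 0 : ℤ) : ℝ) : ℂ) * z + (((γ 1 1 : ℤ) : ℝ) : ℂ)) =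
      ((γ 1 0 : ℝ) * z.re + γ 1 1) ^ 2 + ((γ 1 0 : ℝ) * z.im) ^ 2 := by
    rw [normSq_apply]
    simp only [add_re, mul_re, ofReal_re, UpperHalfPlane.coe_re, ofReal_im, UpperHalfPlane.coe_im,
      zero_mul, sub_zero, add_im, mul_im, add_zero]
    ring
  have hcast : ∀ x : ℤ, ((x : ℂ)) = (((x : ℝ)) : ℂ) := fun x ↦ (ofReal_intCast x).symm
  rw [hcast, hcast, hns] at h1 h2
  by_cases hc : (γ 1 0 : ℤ) = 0
  · have hdet : (γ 0 0 : ℤ) * γ 1 1 - γ 0 1 * γ 1 0 = 1 := by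
      have := Matrix.SpecialLinearGroup.det_coe γ
      rwa [Matrix.det_fin_two] at this
    rw [hc, mul_zero, sub_zero] at hdet
    have hd : ((γ 1 1 : ℤ) : ℝ) ^ 2 = 1 := by
      rcases Int.eq_one_or_neg_one_of_mul_eq_one' hdet with ⟨-, h⟩ | ⟨-, h⟩ <;> simp [h]
    have hone : ((γ 1 0 : ℤ) : ℝ) = 0 := by exact_mod_cast hc
    rw [hone] at h2
    simp only [zero_mul, zero_add, ne_eq, OfNat.ofNat_ne_zero, not_false_eq_true, zero_pow,
      add_zero, hd, div_one] at h2
    exact h2.trans (le_max_left _ _)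
  · have hc1 : (1 : ℝ) ≤ ((γ 1 0 : ℤ) : ℝ) ^ 2 := by
      have h1' : (1 : ℤ) ≤ |γ 1 0| := Int.one_le_abs hc
      have : (1 : ℝ) ≤ |((γ 1 0 : ℤ) : ℝ)| := by exact_mod_cast h1'
      nlinarith [abs_nonneg ((γ 1 0 : ℤ) : ℝ), sq_abs ((γ 1 0 : ℤ) : ℝ)]
    have hy := z.im_pos
    have hge : z.im ^ 2 ≤ ((γ 1 0 : ℝ) * z.re + γ 1 1) ^ 2 + ((γ 1 0 : ℝ) * z.im) ^ 2 := by
      nlinarith [sq_nonneg ((γ 1 0 : ℝ) * z.re + γ 1 1)]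
    have hN : 0 < ((γ 1 0 : ℝ) * z.re + γ 1 1) ^ 2 + ((γ 1 0 : ℝ) * z.im) ^ 2 := by positivity
    have h3 : m ≤ z.im⁻¹ := by
      refine h1.trans ?_
      rw [div_le_iff₀ hN]
      calc z.im = z.im⁻¹ * z.im ^ 2 := by field_simp
        _ ≤ z.im⁻¹ * _ := mul_le_mul_of_nonneg_left hge (inv_nonneg.2 hy.le)
    exact ((le_inv_comm₀ hm hy).1 h3).trans (le_max_right _ _)

/-- The image of `SL(2, ℤ)` in `SL(2, ℝ)`. [folklore] -/
abbrev modularRange : Subgroup SL(2, ℝ) := (Matrix.SpecialLinearGroup.map (Int.castRingHom ℝ)).range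

/-- **Proper discontinuity**: only finitely many `γ ∈ SL(2, ℤ)` move a compact set of `ℍ` to meet a
given compact set (Mathlib: discrete subgroups of `SL(2, ℝ)` act properly discontinuously). [folklore] -/
lemma finite_setOf_smul_inter_nonempty {K L : Set ℍ} (hK : IsCompact K) (hL : IsCompact L) :
    {γ : SL(2, ℤ) | (((γ : SL(2, ℝ)) • ·) '' K ∩ L).Nonempty}.Finite := by
  have hfin := ProperlyDiscontinuousSMul.finite_disjoint_inter_image (Γ := modularRange) hK hL
  let ι : SL(2, ℤ) → modularRange := fun γ ↦ ⟨γ, γ, rfl⟩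
  have hι : Function.Injective ι := fun γ γ' h ↦
    Matrix.SpecialLinearGroup.map_intCast_injective (congrArg Subtype.val h)
  have : {γ : SL(2, ℤ) | (((γ : SL(2, ℝ)) • ·) '' K ∩ L).Nonempty} =
      ι ⁻¹' {σ : modularRange | ((σ • ·) '' K ∩ L).Nonempty} := by
    ext γ; rfl
  rw [this]
  exact hfin.preimage hι.injOn

/-- Points of a moved square are hyperbolically `4`-close, hence their Cayley images satisfy
`‖C z - C w‖ ≤ sinh 2 · √(2 (1 - ‖C z‖))`. [folklore] -/
lemma norm_cayley_sub_le_of_mem_smul_setH (h : SL(2, ℝ)) (Q : TileSquare) {z w : ℍ}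
    (hz : z ∈ (h • ·) '' Q.setH) (hw : w ∈ (h • ·) '' Q.setH) :
    ‖cayleyFun z - cayleyFun w‖ ≤ Real.sinh 2 * Real.sqrt (2 * (1 - ‖cayleyFun z‖)) := by
  obtain ⟨z', hz', rfl⟩ := hz
  obtain ⟨w', hw', rfl⟩ := hw
  refine (norm_cayleyFun_sub_le _ _).trans (mul_le_mul_of_nonneg_right ?_ (Real.sqrt_nonneg _))
  rw [Real.sinh_le_sinh, dist_smul]
  linarith [Q.dist_le_four hz' hw']

/-- Points of a moved square have Cayley images `‖C z - C w‖ ≤ √2 sinh (4 rad)`. [folklore] -/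
lemma norm_cayley_sub_le_sinh_rad (h : SL(2, ℝ)) (Q : TileSquare) {z w : ℍ}
    (hz : z ∈ (h • ·) '' Q.setH) (hw : w ∈ (h • ·) '' Q.setH) :
    ‖cayleyFun z - cayleyFun w‖ ≤ Real.sinh (4 * Q.rad) * Real.sqrt 2 := by
  obtain ⟨z', hz', rfl⟩ := hz
  obtain ⟨w', hw', rfl⟩ := hw
  refine (norm_cayleyFun_sub_le _ _).trans ?_
  have h1 : Real.sinh (dist (h • z') (h • w') / 2) ≤ Real.sinh (4 * Q.rad) := by
    rw [Real.sinh_le_sinh, dist_smul]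
    linarith [Q.dist_le_eight_mul_rad hz' hw']
  have h2 : Real.sqrt (2 * (1 - ‖cayleyFun ((h • z' : ℍ) : ℂ)‖)) ≤ Real.sqrt 2 :=
    Real.sqrt_le_sqrt (by linarith [norm_nonneg (cayleyFun ((h • z' : ℍ) : ℂ))])
  have h3 : 0 ≤ Real.sinh (4 * Q.rad) := Real.sinh_nonneg_iff.2 (by linarith [Q.rad_pos])
  have h4 : 0 ≤ Real.sinh (dist (h • z') (h • w') / 2) := Real.sinh_nonneg_iff.2 (by positivity)
  exact mul_le_mul h1 h2 (Real.sqrt_nonneg _) h3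

/-- The trace of a moved square loop read through the Cayley transform lies in `C (h • Q)`. [folklore] -/
lemma range_sqCurve_cayleyH_subset (h : SL(2, ℝ)) (Q : TileSquare) :
    (sqCurve cayleyH h Q).range ⊆ (fun z : ℍ ↦ cayleyFun z) '' ((h • ·) '' Q.setH) := by
  rw [range_sqCurve]
  rintro _ ⟨z, hz, rfl⟩
  exact ⟨z, image_mono Q.bdryH_subset_setH hz, rfl⟩

/-- **Diameter bound I**: the trace of a moved square loop in the disc has diameter
`≤ √2 sinh (4 rad)` — small for fine squares, uniformly in the motion. [folklore] -/
lemma diam_range_sqCurve_le_sinh (h : SL(2, ℝ)) (Q : TileSquare) :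
    diam (sqCurve cayleyH h Q).range ≤ Real.sinh (4 * Q.rad) * Real.sqrt 2 := by
  refine diam_le_of_forall_dist_le (mul_nonneg (Real.sinh_nonneg_iff.2 (by linarith [Q.rad_pos]))
    (Real.sqrt_nonneg _)) ?_
  intro x hx y hy
  obtain ⟨z, hz, rfl⟩ := range_sqCurve_cayleyH_subset h Q hx
  obtain ⟨w, hw, rfl⟩ := range_sqCurve_cayleyH_subset h Q hy
  rw [dist_eq_norm]
  exact norm_cayley_sub_le_sinh_rad h Q hz hw

/-- **Diameter bound II**: if some point of the moved square is `η`-close to the unit circle in the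
disc, the trace of the loop has diameter `≤ 2 sinh 2 √(2η)`. [folklore] -/
lemma diam_range_sqCurve_le_of_mem (h : SL(2, ℝ)) (Q : TileSquare) {z₀ : ℍ}
    (hz₀ : z₀ ∈ (h • ·) '' Q.setH) {η : ℝ} (hη : 1 - ‖cayleyFun z₀‖ ≤ η) :
    diam (sqCurve cayleyH h Q).range ≤ 2 * (Real.sinh 2 * Real.sqrt (2 * η)) := by
  have hb : ∀ x ∈ (sqCurve cayleyH h Q).range, dist x (cayleyFun z₀) ≤ Real.sinh 2 * Real.sqrt (2 * η) := by
    intro x hx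
    obtain ⟨z, hz, rfl⟩ := range_sqCurve_cayleyH_subset h Q hx
    rw [dist_comm, dist_eq_norm]
    refine (norm_cayley_sub_le_of_mem_smul_setH h Q hz₀ hz).trans ?_
    exact mul_le_mul_of_nonneg_left (Real.sqrt_le_sqrt (by linarith))
      (Real.sinh_nonneg_iff.2 (by norm_num))
  refine diam_le_of_forall_dist_le (by positivity) fun x hx y hy ↦ ?_
  calc dist x y ≤ dist x (cayleyFun z₀) + dist y (cayleyFun z₀) := dist_triangle_right _ _ _
    _ ≤ _ := by linarith [hb x hx, hb y hy]

/-- **Local finiteness of the family of square loops**: for every `δ > 0` only finitely many loops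
`C ((g⁻¹ γ) • ∂Q)` have diameter `> δ`. Large loops come from coarse squares (`rad` bounded below) whose
translate `γ • Q` stays away from the circle, i.e. inside a fixed compact set of `ℍ`; by the cusp
estimate and proper discontinuity only finitely many `γ`, and by the index bounds only finitely many
`Q`, qualify. [folklore] -/
theorem locFin_sqFamily (g : SL(2, ℝ)) : CurveClass.LocFin (sqFamily cayleyH g) := by
  intro δ hδ
  -- constants
  set s : ℝ := Real.sinh 2 with hs
  have hs0 : 0 < s := Real.sinh_pos_iff.2 (by norm_num)
  set η : ℝ := δ ^ 2 / (8 * (s + 1) ^ 2) with hη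
  have hη0 : 0 < η := by positivity
  have hη1 : 2 * (s * Real.sqrt (2 * η)) < δ := by
    have : Real.sqrt (2 * η) = δ / (2 * (s + 1)) := by
      rw [hη, show 2 * (δ ^ 2 / (8 * (s + 1) ^ 2)) = (δ / (2 * (s + 1))) ^ 2 by field_simp; ring]
      exact Real.sqrt_sq (by positivity)
    rw [this]
    have h1 : 2 * (s * (δ / (2 * (s + 1)))) = δ * (s / (s + 1)) := by field_simp
    rw [h1]
    have h2 : s / (s + 1) < 1 := (div_lt_one (by positivity)).2 (by linarith)
    nlinarith
  -- the compact sets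
  set K : Set ℍ := {z | ‖cayleyFun z‖ ≤ 1 - η} with hK
  have hKc : IsCompact K := isCompact_setOf_norm_cayleyFun_le hη0
  set K₁ : Set ℍ := insert UpperHalfPlane.I ((g • ·) '' K) with hK₁
  have hK₁c : IsCompact K₁ := (hKc.image (continuous_const_smul g)).insert _
  have hK₁ne : K₁.Nonempty := ⟨_, mem_insert _ _⟩
  obtain ⟨zm, hzm, hzmin⟩ := hK₁c.exists_isMinOn hK₁ne continuous_im.continuousOn
  obtain ⟨zM, hzM, hzmax⟩ := hK₁c.exists_isMaxOn hK₁ne continuous_im.continuousOn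
  set m : ℝ := zm.im with hm
  set M : ℝ := zM.im with hM
  have hm0 : 0 < m := zm.im_pos
  set Y : ℝ := max M m⁻¹ with hY
  -- the level bound
  obtain ⟨k₀, hk₀⟩ := exists_dyRad_lt (show 0 < Real.arsinh (δ / 2) / 4 by
    have : 0 < Real.arsinh (δ / 2) := Real.arsinh_pos_iff.2 (by positivity)
    positivity)
  -- Claim A: large loops have translate in `K₁` and coarse level
  have claimA : ∀ (γ : SL(2, ℤ)) (Q : TileSquare),
      δ < diam (CurveClass.mk (sqCurve cayleyH (g⁻¹ * (γ : SL(2, ℝ))) Q)).range →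
        (((γ : SL(2, ℝ)) • ·) '' Q.setH ⊆ K₁) ∧ Q.k < k₀ := by
    intro γ Q hdiam
    rw [CurveClass.range_mk] at hdiam
    constructor
    · rintro _ ⟨q, hq, rfl⟩
      refine mem_insert_of_mem _ ⟨(g⁻¹ * (γ : SL(2, ℝ))) • q, ?_, by simp only [mul_smul, smul_inv_smul]⟩
      -- if the point were `η`-close to the circle the loop would be small
      by_contra hfar
      simp only [hK, mem_setOf_eq, not_le] at hfar
      have hsmall := diam_range_sqCurve_le_of_mem (g⁻¹ * (γ : SL(2, ℝ))) Q ⟨q, hq, rfl⟩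
        (show 1 - ‖cayleyFun (((g⁻¹ * (γ : SL(2, ℝ))) • q : ℍ) : ℂ)‖ ≤ η by linarith)
      linarith
    · by_contra hk
      rw [not_lt] at hk
      have hsmall := diam_range_sqCurve_le_sinh (g⁻¹ * (γ : SL(2, ℝ))) Q
      have hrad : Q.rad < Real.arsinh (δ / 2) / 4 := hk₀ Q.k hk
      have h1 : Real.sinh (4 * Q.rad) < δ / 2 := by
        calc Real.sinh (4 * Q.rad) < Real.sinh (Real.arsinh (δ / 2)) :=
              Real.sinh_lt_sinh.2 (by linarith)
          _ = δ / 2 := Real.sinh_arsinh _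
      have h2 : Real.sqrt 2 ≤ 2 := by
        rw [Real.sqrt_le_left (by norm_num)]; norm_num
      have h3 : 0 ≤ Real.sinh (4 * Q.rad) := Real.sinh_nonneg_iff.2 (by linarith [Q.rad_pos])
      nlinarith
  -- Claim B: finiteness of the qualifying indices
  set FΓ : Set SL(2, ℤ) :=
    {γ | ((((γ : SL(2, ℝ)) • ·) '' ModularGroup.truncatedFundamentalDomain Y) ∩ K₁).Nonempty} with hFΓ
  have hFΓ_fin : FΓ.Finite :=
    finite_setOf_smul_inter_nonempty (ModularGroup.isCompact_truncatedFundamentalDomain Y) hK₁c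
  set FQ : Set TileSquare := {Q | Q.k < k₀ ∧ |Q.a| ≤ 2 ^ k₀ ∧ 0 ≤ Q.b ∧ (Q.b : ℝ) ≤ (Y + 2) * 2 ^ k₀}
    with hFQ
  have hFQ_fin : FQ.Finite := by
    have hT : (↑(Finset.range k₀) ×ˢ (Icc (-(2 : ℤ) ^ k₀) (2 ^ k₀) ×ˢ
        Icc (0 : ℤ) ⌈(Y + 2) * 2 ^ k₀⌉) : Set (ℕ × ℤ × ℤ)).Finite :=
      (Finset.finite_toSet _).prod ((finite_Icc _ _).prod (finite_Icc _ _))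
    refine (hT.preimage TileSquare.injective_index.injOn).subset fun Q hQ ↦ ?_
    obtain ⟨h1, h2, h3, h4⟩ := hQ
    simp only [mem_preimage, mem_prod, Finset.coe_range, mem_Iio, mem_Icc]
    refine ⟨h1, abs_le.1 h2, h3, ?_⟩
    exact Int.le_ceil_iff.2 (by linarith)
  have claimB : ∀ (γ : SL(2, ℤ)) (Q : TileSquare),
      (((γ : SL(2, ℝ)) • ·) '' Q.setH ⊆ K₁) → Q.k < k₀ → γ ∈ FΓ ∧ Q ∈ FQ := by
    intro γ Q hsub hk
    obtain ⟨q, hq⟩ := Q.setH_nonempty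
    have hγq : (γ : SL(2, ℝ)) • q ∈ K₁ := hsub ⟨q, hq, rfl⟩
    have him : q.im ≤ Y := by
      have h1 : m ≤ (γ • q).im := by rw [← coe_smul_eq]; exact hzmin hγq
      have h2 : (γ • q).im ≤ M := by rw [← coe_smul_eq]; exact hzmax hγq
      exact im_le_of_im_smul_mem hm0 h1 h2
    refine ⟨⟨(γ : SL(2, ℝ)) • q, ⟨q, ⟨Q.setH_subset_fd hq, him⟩, rfl⟩, hγq⟩, hk, ?_, Q.b_nonneg, ?_⟩
    · exact Q.abs_a_le.trans (pow_le_pow_right₀ (by norm_num) hk.le)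
    · refine (Q.b_le_of_exists_im_le ⟨q, hq, him⟩).trans ?_
      have hY2 : 0 ≤ Y + 2 := by
        have : 0 ≤ m⁻¹ := inv_nonneg.2 hm0.le
        linarith [le_max_right M m⁻¹]
      exact mul_le_mul_of_nonneg_left (pow_le_pow_right₀ (by norm_num) hk.le) hY2
  -- assemble
  refine ((hFΓ_fin.prod hFQ_fin).image fun i : SL(2, ℤ) × TileSquare ↦
    CurveClass.mk (sqCurve cayleyH (g⁻¹ * (i.1 : SL(2, ℝ))) i.2)).subset ?_
  rintro c ⟨⟨⟨γ, Q⟩, rfl⟩, hc⟩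
  obtain ⟨hA1, hA2⟩ := claimA γ Q hc
  exact ⟨(γ, Q), mk_mem_prod (claimB γ Q hA1 hA2).1 (claimB γ Q hA1 hA2).2, rfl⟩

/-- The collection `modularLoops g` is locally finite (finitely many members of diameter `> ε`). [folklore] -/
theorem isLocallyFinite_modularLoops (g : SL(2, ℝ)) : (modularLoops g).IsLocallyFinite :=
  (locFin_sqFamily g).closure

/-! ### Non-crossing -/

/-- **Transport of non-crossing witnesses.** If `S ⊆ ℍ` is preconnected and nonempty, `A ⊆ closure S`
and `S` misses `B`, then for an injective continuous `T : ℍ → ℂ` the set `T(A)` lies in the closure of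
a single connected component of the complement of `T(B)`. [folklore] -/
lemma exists_nonCrossing_witness {T : C(ℍ, ℂ)} (hT : Function.Injective T) {S A B : Set ℍ}
    (hS : IsPreconnected S) (hSne : S.Nonempty) (hA : A ⊆ closure S) (hB : Disjoint S B) :
    ∃ z ∉ T '' B, T '' A ⊆ closure (connectedComponentIn (T '' B)ᶜ z) := by
  obtain ⟨s₀, hs₀⟩ := hSne
  have hsub : T '' S ⊆ (T '' B)ᶜ := by
    rintro _ ⟨x, hx, rfl⟩ ⟨b, hb, hbx⟩
    exact hB.ne_of_mem hx hb (hT hbx).symm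
  refine ⟨T s₀, fun h ↦ hsub ⟨s₀, hs₀, rfl⟩ h, ?_⟩
  calc T '' A ⊆ T '' closure S := image_mono hA
    _ ⊆ closure (T '' S) := image_closure_subset_closure_image T.continuous
    _ ⊆ closure (connectedComponentIn (T '' B)ᶜ (T s₀)) :=
        closure_mono ((hS.image T T.continuous.continuousOn).subset_connectedComponentIn
          ⟨s₀, hs₀, rfl⟩ hsub)

namespace TileSquare

variable (Q : TileSquare)

/-- The closure in `ℍ` of the open square is the closed square. [folklore] -/
lemma closure_intH : closure Q.intH = Q.setH := by
  rw [intH, ← UpperHalfPlane.isOpenEmbedding_coe.isOpenMap.preimage_closure_eq_closure_preimage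
    continuous_coe, closure_sqInt_eq Q.rad_pos]
  rfl

/-- The closure in `ℍ` of the complement of the closed square is the complement of the open square. [folklore] -/
lemma closure_compl_setH : closure Q.setHᶜ = Q.intHᶜ := by
  rw [setH, ← preimage_compl,
    ← UpperHalfPlane.isOpenEmbedding_coe.isOpenMap.preimage_closure_eq_closure_preimage continuous_coe,
    closure_compl, cset, interior_sqSet_eq Q.rad_pos]
  rfl

/-- The open square is preconnected in `ℍ`. [folklore] -/
lemma isPreconnected_intH : IsPreconnected Q.intH := by
  rw [← UpperHalfPlane.isEmbedding_coe.isInducing.isPreconnected_image, image_coe_intH]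
  exact isPreconnected_sqInt _ _

/-- The complement of the closed square is preconnected in `ℍ`. [folklore] -/
lemma isPreconnected_compl_setH : IsPreconnected Q.setHᶜ := by
  rw [← UpperHalfPlane.isEmbedding_coe.isInducing.isPreconnected_image]
  have : ((↑) : ℍ → ℂ) '' Q.setHᶜ = {p : ℂ | 0 < p.im} \ Q.cset := by
    rw [setH, ← preimage_compl, image_preimage_eq_inter_range, UpperHalfPlane.range_coe, sdiff_eq, inter_comm]
  rw [this]
  have hc : Q.center ∈ Q.cset := sqInt_subset_sqSet _ _ (center_mem_sqInt Q.center Q.rad_pos)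
  exact isPreconnected_upperHalfPlane_diff_sqSet Q.rad_pos.le
    (lt_of_le_of_lt Q.rad_le_half (Q.half_lt_im_of_mem_cset hc))

/-- The open square is nonempty (it contains the centre). [folklore] -/
lemma intH_nonempty : Q.intH.Nonempty :=
  ⟨⟨Q.center, Q.im_pos_of_mem_cset (sqInt_subset_sqSet _ _ (center_mem_sqInt Q.center Q.rad_pos))⟩,
    center_mem_sqInt Q.center Q.rad_pos⟩

/-- The complement of the closed square is nonempty (the point one unit above the centre). [folklore] -/
lemma compl_setH_nonempty : Q.setHᶜ.Nonempty := by
  have hc : Q.center ∈ Q.cset := sqInt_subset_sqSet _ _ (center_mem_sqInt Q.center Q.rad_pos)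
  have him : 0 < Q.center.im + 1 := by linarith [Q.im_pos_of_mem_cset hc]
  refine ⟨⟨⟨Q.center.re, Q.center.im + 1⟩, him⟩, fun hmem ↦ ?_⟩
  have h1 : boxNorm ((⟨Q.center.re, Q.center.im + 1⟩ : ℂ) - Q.center) ≤ Q.rad := hmem
  have h2 : |((⟨Q.center.re, Q.center.im + 1⟩ : ℂ) - Q.center).im| ≤ Q.rad :=
    (abs_im_le_boxNorm _).trans h1
  simp only [sub_im, add_sub_cancel_left, abs_one] at h2
  linarith [Q.rad_le_half]

/-- The open square misses the boundary. [folklore] -/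
lemma disjoint_intH_bdryH : Disjoint Q.intH Q.bdryH :=
  disjoint_iff_inter_eq_empty.2 (by rw [intH, bdryH, ← preimage_inter, sqInt_inter_sqBdry, preimage_empty])

/-- The complement of the closed square misses the boundary. [folklore] -/
lemma disjoint_compl_setH_bdryH : Disjoint Q.setHᶜ Q.bdryH :=
  disjoint_compl_left.mono_right Q.bdryH_subset_setH

end TileSquare

/-- **Tile-frame dichotomy.** For `γ ∈ SL(2, ℤ)` and tile squares `Q₁, Q₂`, the translate `γ • ∂Q₁`
either lies in the closed square `Q₂` or misses the open square `Q₂`: different tiles are disjoint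
(`ModularGroup.eq_one_or_neg_one_of_mem_fdo_mem_fdo`), and two dyadic squares of one tile are nested or
have disjoint interiors. [folklore] -/
lemma smul_bdryH_subset_or_disjoint (γ : SL(2, ℤ)) (Q₁ Q₂ : TileSquare) :
    ((γ : SL(2, ℝ)) • ·) '' Q₁.bdryH ⊆ Q₂.setH ∨ Disjoint (((γ : SL(2, ℝ)) • ·) '' Q₁.bdryH) Q₂.intH := by
  by_cases hγ : γ = 1 ∨ γ = -1
  · have htriv : ((γ : SL(2, ℝ)) • ·) '' Q₁.bdryH = Q₁.bdryH := by
      have : ∀ z : ℍ, (γ : SL(2, ℝ)) • z = z := fun z ↦ by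
        rw [coe_smul_eq]
        rcases hγ with rfl | rfl
        · exact one_smul _ _
        · rw [ModularGroup.SL_neg_smul, one_smul]
      simp only [this, image_id']
    rw [htriv]
    rcases dySq_trichotomy Q₁.k Q₂.k Q₁.a Q₁.b Q₂.a Q₂.b with h | h | h
    · exact Or.inl (Q₁.bdryH_subset_setH.trans fun z hz ↦ h hz)
    · right
      have h' : Q₂.cset ⊆ Q₁.cset := h
      rw [TileSquare.bdryH, TileSquare.intH, disjoint_iff_inter_eq_empty, ← preimage_inter,
        sqBdry_inter_sqInt_eq_empty_of_subset Q₁.rad_pos Q₂.rad_pos h', preimage_empty]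
    · right
      have h' : sqSet Q₁.center Q₁.rad ∩ sqInt Q₂.center Q₂.rad = ∅ :=
        sqSet_inter_sqInt_eq_empty Q₁.rad_pos h
      rw [TileSquare.bdryH, TileSquare.intH, disjoint_iff_inter_eq_empty, ← preimage_inter,
        ← subset_empty_iff]
      rw [← subset_empty_iff] at h'
      exact (preimage_mono ((inter_subset_inter_left _ (sqBdry_subset_sqSet _ _)).trans h')).trans
        (by rw [preimage_empty])
  · right
    rw [disjoint_left]
    rintro _ ⟨z, hz, rfl⟩ hint
    have hz' : z ∈ 𝒟ᵒ := Q₁.setH_subset_fdo (Q₁.bdryH_subset_setH hz)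
    have hγz : γ • z ∈ 𝒟ᵒ := by
      rw [← coe_smul_eq]
      exact Q₂.setH_subset_fdo (Q₂.intH_subset_setH hint)
    exact hγ (ModularGroup.eq_one_or_neg_one_of_mem_fdo_mem_fdo hz' hγz)

/-- **Non-crossing of two loops of the family.** For injective continuous `T`, `h ∈ SL(2, ℝ)`,
`γ₁, γ₂ ∈ SL(2, ℤ)` and tile squares `Q₁, Q₂`, the trace of `T (h γ₁ • ∂Q₁)` lies in the closure of a
single connected component of the complement of the trace of `T (h γ₂ • ∂Q₂)`. [folklore] -/
theorem range_sqCurve_subset_closure_component {T : C(ℍ, ℂ)} (hT : Function.Injective T)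
    (h : SL(2, ℝ)) (γ₁ γ₂ : SL(2, ℤ)) (Q₁ Q₂ : TileSquare) :
    ∃ z ∉ (sqCurve T (h * (γ₂ : SL(2, ℝ))) Q₂).range,
      (sqCurve T (h * (γ₁ : SL(2, ℝ))) Q₁).range ⊆
        closure (connectedComponentIn ((sqCurve T (h * (γ₂ : SL(2, ℝ))) Q₂).range)ᶜ z) := by
  set γ : SL(2, ℤ) := γ₂⁻¹ * γ₁ with hγ
  -- the tile-frame witness `S''`
  obtain ⟨S'', hS''c, hS''ne, hA'', hB''⟩ : ∃ S'' : Set ℍ, IsPreconnected S'' ∧ S''.Nonempty ∧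
      ((γ : SL(2, ℝ)) • ·) '' Q₁.bdryH ⊆ closure S'' ∧ Disjoint S'' Q₂.bdryH := by
    rcases smul_bdryH_subset_or_disjoint γ Q₁ Q₂ with hsub | hdisj
    · exact ⟨Q₂.intH, Q₂.isPreconnected_intH, Q₂.intH_nonempty, by rwa [Q₂.closure_intH],
        Q₂.disjoint_intH_bdryH⟩
    · refine ⟨Q₂.setHᶜ, Q₂.isPreconnected_compl_setH, Q₂.compl_setH_nonempty, ?_,
        Q₂.disjoint_compl_setH_bdryH⟩
      rw [Q₂.closure_compl_setH]
      exact hdisj.subset_compl_right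
  -- move everything by the homeomorphism `h γ₂ • ·`
  set φ : ℍ ≃ₜ ℍ := Homeomorph.smul (h * (γ₂ : SL(2, ℝ))) with hφ
  have hφapply : ∀ z : ℍ, φ z = (h * (γ₂ : SL(2, ℝ))) • z := fun z ↦ rfl
  have hset : φ '' (((γ : SL(2, ℝ)) • ·) '' Q₁.bdryH) = ((h * (γ₁ : SL(2, ℝ))) • ·) '' Q₁.bdryH := by
    rw [image_image]
    refine image_congr fun z _ ↦ ?_
    change (h * (γ₂ : SL(2, ℝ))) • ((γ : SL(2, ℝ)) • z) = (h * (γ₁ : SL(2, ℝ))) • z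
    rw [← mul_smul, hγ, map_mul, map_inv, mul_assoc, mul_inv_cancel_left]
  have hrange₁ : (sqCurve T (h * (γ₁ : SL(2, ℝ))) Q₁).range =
      T '' (φ '' (((γ : SL(2, ℝ)) • ·) '' Q₁.bdryH)) := by
    rw [range_sqCurve, hset]
  have hrange₂ : (sqCurve T (h * (γ₂ : SL(2, ℝ))) Q₂).range = T '' (φ '' Q₂.bdryH) := by
    rw [range_sqCurve]; rfl
  rw [hrange₁, hrange₂]
  refine exists_nonCrossing_witness hT (S := φ '' S'') ((hS''c.image φ φ.continuous.continuousOn))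
    (hS''ne.image φ) ?_ ?_
  · rw [← φ.image_closure]
    exact image_mono hA''
  · exact (disjoint_image_iff φ.injective).2 hB''

/-- **A collection whose non-trivial members belong to the family is non-crossing** (for injective
continuous `T`). [folklore] -/
theorem isNonCrossing_of_subset_sqFamily {T : C(ℍ, ℂ)} (hT : Function.Injective T) (g : SL(2, ℝ))
    {L : LoopSpace ℂ} (hL : ∀ c ∈ L, ¬ c.IsTrivial → c ∈ sqFamily T g) : L.IsNonCrossing := by
  intro c hc c' hc' _ hct hc't
  obtain ⟨⟨γ₁, Q₁⟩, rfl⟩ := hL c hc hct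
  obtain ⟨⟨γ₂, Q₂⟩, rfl⟩ := hL c' hc' hc't
  simp only [CurveClass.range_mk]
  exact ⟨range_sqCurve_subset_closure_component hT g⁻¹ γ₁ γ₂ Q₁ Q₂,
    range_sqCurve_subset_closure_component hT g⁻¹ γ₂ γ₁ Q₂ Q₁⟩

/-! ### Hitting a square boundary -/

/-- **A non-degenerate connected subset of `ℍ` through a point of `𝒟ᵒ` meets the boundary of some tile
square**: choose a dyadic square around the point, inside `𝒟ᵒ` and too small to contain a second point
of the set, and apply the intermediate value theorem to the box distance. [folklore] -/
theorem exists_tileSquare_inter_nonempty {K : Set ℍ} (hK : IsPreconnected K) {p q : ℍ} (hp : p ∈ K)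
    (hq : q ∈ K) (hpq : p ≠ q) (hp𝒟 : p ∈ 𝒟ᵒ) : ∃ Q : TileSquare, (K ∩ Q.bdryH).Nonempty := by
  have hpq' : (p : ℂ) ≠ q := fun h ↦ hpq (UpperHalfPlane.ext h)
  have hd : 0 < dist (p : ℂ) q := dist_pos.2 hpq'
  set U : Set ℂ := fdoC ∩ ball (p : ℂ) (dist (p : ℂ) q) with hU
  have hUo : IsOpen U := isOpen_fdoC.inter isOpen_ball
  have hpU : (p : ℂ) ∈ U := ⟨(mem_fdo_iff_coe_mem_fdoC p).1 hp𝒟, mem_ball_self hd⟩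
  obtain ⟨k₀, hk₀⟩ := exists_dySq_subset hUo hpU
  obtain ⟨a, b, hpQ, hQU⟩ := hk₀ k₀ le_rfl
  let Q : TileSquare := ⟨k₀, a, b, hQU.trans inter_subset_left⟩
  refine ⟨Q, ?_⟩
  have hqQ : (q : ℂ) ∉ sqSet (dyCenter k₀ a b) (dyRad k₀) := fun hmem ↦ by
    have := (hQU hmem).2
    rw [mem_ball, dist_comm] at this
    exact lt_irrefl _ this
  obtain ⟨x, ⟨z, hzK, rfl⟩, hx⟩ := exists_mem_sqBdry_of_isPreconnected
    (hK.image _ continuous_coe.continuousOn) (mem_image_of_mem _ hp) hpQ (mem_image_of_mem _ hq) hqQ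
  exact ⟨z, hzK, hx⟩

/-! ### Infinitely many distinct loops -/

/-- The left-edge midpoint `(-1/4, (8 + n)/4 + 1/8)` of the cusp square `high n`. [folklore] -/
def highPt (n : ℕ) : ℍ :=
  ⟨⟨-4⁻¹, (8 + n) / 4 + 8⁻¹⟩, by change (0 : ℝ) < (8 + n) / 4 + 8⁻¹; positivity⟩

/-- The centre of `high n` is `(-1/8, (8 + n)/4 + 1/8)` and its half-side is `1/8`. [folklore] -/
lemma center_high (n : ℕ) : (TileSquare.high n).center = ⟨-8⁻¹, (8 + n) / 4 + 8⁻¹⟩ := by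
  apply Complex.ext <;> simp [TileSquare.center, TileSquare.high, dyCenter] <;> ring

/-- The half-side of `high n` is `1/8`. [folklore] -/
lemma rad_high (n : ℕ) : (TileSquare.high n).rad = 8⁻¹ := by
  simp [TileSquare.rad, TileSquare.high, dyRad]; norm_num

/-- `highPt n` lies on the boundary of `high m` iff `m = n`. [folklore] -/
lemma highPt_mem_bdryH_iff (n m : ℕ) : highPt n ∈ (TileSquare.high m).bdryH ↔ m = n := by
  change boxNorm ((⟨-4⁻¹, (8 + n) / 4 + 8⁻¹⟩ : ℂ) - (TileSquare.high m).center) =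
    (TileSquare.high m).rad ↔ _
  rw [center_high, rad_high, boxNorm_def]
  have hre : ((⟨-4⁻¹, (8 + n) / 4 + 8⁻¹⟩ : ℂ) - ⟨-8⁻¹, (8 + m) / 4 + 8⁻¹⟩).re = -8⁻¹ := by
    simp only [sub_re]; norm_num
  have him : ((⟨-4⁻¹, (8 + n) / 4 + 8⁻¹⟩ : ℂ) - ⟨-8⁻¹, (8 + m) / 4 + 8⁻¹⟩).im = ((n : ℝ) - m) / 4 := by
    simp only [sub_im]; ring
  rw [hre, him, abs_neg, abs_of_pos (by norm_num : (0 : ℝ) < 8⁻¹)]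
  constructor
  · intro h
    have h1 : |((n : ℝ) - m) / 4| ≤ 8⁻¹ := by rw [← h]; exact le_max_right _ _
    rw [abs_le] at h1
    have h2 : |(n : ℝ) - m| < 1 := by rw [abs_lt]; constructor <;> linarith [h1.1, h1.2]
    have h3 : |(n : ℤ) - m| < 1 := by exact_mod_cast h2
    rw [abs_lt] at h3
    omega
  · rintro rfl
    simp

/-- **The family contains infinitely many distinct loops** (for injective `T`): the loops of the cusp
squares `high n` are pairwise distinct, as the point `T (h • highPt n)` lies on exactly one of them.
[folklore] -/
theorem infinite_sqFamily {T : C(ℍ, ℂ)} (hT : Function.Injective T) (g : SL(2, ℝ)) :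
    (sqFamily T g).Infinite := by
  have hinj : Function.Injective fun n : ℕ ↦
      CurveClass.mk (sqCurve T (g⁻¹ * ((1 : SL(2, ℤ)) : SL(2, ℝ))) (TileSquare.high n)) := by
    intro n m h
    have hr := congrArg CurveClass.range h
    simp only [CurveClass.range_mk, range_sqCurve] at hr
    have hmem : T ((g⁻¹ * ((1 : SL(2, ℤ)) : SL(2, ℝ))) • highPt n) ∈
        T '' (((g⁻¹ * ((1 : SL(2, ℤ)) : SL(2, ℝ))) • ·) '' (TileSquare.high m).bdryH) := by
      rw [← hr]
      exact ⟨_, ⟨highPt n, (highPt_mem_bdryH_iff n n).2 rfl, rfl⟩, rfl⟩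
    obtain ⟨_, ⟨z, hz, rfl⟩, hTz⟩ := hmem
    have hz' : z = highPt n := smul_left_cancel _ (hT hTz)
    rw [hz'] at hz
    exact ((highPt_mem_bdryH_iff n m).1 hz).symm
  exact infinite_of_injective_forall_mem hinj fun n ↦ ⟨((1 : SL(2, ℤ)), TileSquare.high n), rfl⟩

end ModularEnsemble

end Literature.Probability.RandomPlanarGeometry
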